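import Summits.KontsevichZagierPeriods.KontsevichZagierPeriods.Theorems.UnfoldedStokesStokesGenerationFibrewiseRungScaling
import Summits.KontsevichZagierPeriods.KontsevichZagierPeriods.Theorems.UnfoldedStokesStokesGenerationStubAdjugateBlockTriangular
import Summits.KontsevichZagierPeriods.KontsevichZagierPeriods.Theorems.UnfoldedStokesStokesGenerationStubAdjugateMulVecFace
import Summits.KontsevichZagierPeriods.KontsevichZagierPeriods.Theorems.UnfoldedStokesStokesGenerationStubJacobianMatrixSuspension
import Summits.KontsevichZagierPeriods.KontsevichZagierPeriods.Theorems.UnfoldedStokesStokesGenerationStubSuspensionRegularity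
import Summits.KontsevichZagierPeriods.KontsevichZagierPeriods.Theorems.UnfoldedStokesStokesGenerationStubSuspensionSemialgebraic
import Literature.Analysis.Calculus.JacobianNullLagrangian
import Literature.NumberTheory.Transcendental.SemialgebraicLineDeriv
import Mathlib.Analysis.Calculus.Deriv.Pi

/-!
# `StokesGeneration` (stmt-KontsevichZagierPeriods-3586), line `fibrewise_stokes` — rung 15: Kontsevich–Zagier's rule (2)
# for general face-preserving `C²` self-maps of the closed cube, in every dimension

Crux `Summit.KontsevichZagierPeriods.KontsevichZagierPeriods.Theses.UnfoldedStokes.StokesGeneration` (the kernel conjecture of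
the Kontsevich–Zagier calculus; kernel-checked equivalent to the summit); residual stub S2 `stub_fibrewiseStokesGeneration`
(fibrewise Stokes generation on closed unit cubes; the S2 class `FibStokesDecomposable`, `Theorems/UnfoldedStokesDefs.lean`).
Rungs 11–14 (lead c5) absorbed the soft relators of the cubical calculus — cube symmetries, TRIANGULAR (one coordinate at a
time) semialgebraic `C¹` reparametrisations, subdivisions — into S2's economy, leaving rule (2) for NON-triangular maps as the
geometric residue (frontier item C3: "needs Jacobi's formula and the Piola identity in Lean"). Both are in the tree
(`Literature/Analysis/Calculus/JacobianNullLagrangian.lean`: the Jacobian determinant is a null Lagrangian), and this file closes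
C3: for an open `U ⊇ [0,1]^N`, a `ℚ`-semialgebraic `C¹` integrand `h` on `U` and a `ℚ`-semialgebraic `C²` map `Φ : U → ℝ^N`
mapping the closed cube into itself and each closed face `{x_j = c}` (`c ∈ {0,1}`) into itself — no injectivity asked — the
change-of-variables relator `h − (h∘Φ)·det DΦ` is fibrewise-Stokes decomposable (`fibStokesDecomposable_sub_pullback`).

Certificate (`N + 1` elements on `[0,1]^{N+1}`, transcendence-free, value-free). Suspend the straight-line homotopy:
`F(x,t) = ((1−t)x + tΦ(x), t)` on `ℝ^{N+1}` (coordinates `x = z ∘ castSucc`, `t = z last`) and put `G(y) = h(y ∘ castSucc)·e_last`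
(`div G = 0`). The Piola field `W = adj(DF)·(G∘F)` (`Literature.Analysis.Calculus.piolaField F G`) has
`W_last = (h∘Φ_t)·det DΦ_t` and `W_j = −(h∘Φ_t)·(adj(DΦ_t)(Φ − id))_j` (`stub_adjugate_blockTriangular` on the block matrix
`DF = [[(1−t)I + tDΦ, Φ − x],[0, 1]]`, `stub_jacobianMatrix_suspension`), and the tree's null-Lagrangian identity
`Literature.Analysis.Calculus.sum_fderiv_piolaField` (Jacobi's formula + Piola's identity) reads `div W = (div G)∘F·det DF = 0`.
The S2 elements are `G_j := W_j` along the coordinate `j` itself, `D_j := ∂_j W_j` (so `Σ_j D_j = 0`); the `t`-faces give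
`W_last|_{t=1} − W_last|_{t=0} = (h∘Φ)·det DΦ − h`, and the `x_j`-faces vanish: `Φ` preserves the face `{x_j = c}`, so on it the
tangential derivatives of `Φ_j` vanish (`stub_jacobianMatrix_suspension`, part 2), row `j` of `DΦ_t` is a multiple of `e_j` and
`(Φ − id)_j = 0`, whence `(adj(DΦ_t)(Φ − id))_j = 0` (`stub_adjugate_mulVec_face`). Regularity (`C²`/`C¹`, openness of
`W' = {x ∈ U, Φ_t(x) ∈ U}`) is `stub_suspension_regularity`; `ℚ`-semialgebraicity of the elements and of their fibre
derivatives (partial derivatives of semialgebraic functions, Basu–Pollack–Roy Prop. 3.22) is `stub_suspension_semialgebraic`.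

Upshot for the line: together with rungs 12–14, EVERY move of the smooth cubical calculus (fibrewise Stokes, hyperoctahedral
symmetries, `C²` face-preserving self-maps of the cube — triangular or not —, subdivisions) is a theorem of S2's economy; the
converse programme "summit ⇒ S2(C¹)" is reduced to the cubification of general semialgebraic domains (frontier item C4).

References: M. Kontsevich, D. Zagier, *Periods* (2001), §1.2 rule (2); L. C. Evans, *Partial Differential Equations* (2010),
§8.1.4.b (null Lagrangians); J. Ayoub, Ann. of Math. 181 (2015), Rem. 1.5.
-/

noncomputable section

-- `Summit.KontsevichZagierPeriods.KontsevichZagierPeriods.…` is the tree's mandated layout (single-conjunct summit).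
set_option linter.dupNamespace false

namespace Summit.KontsevichZagierPeriods.KontsevichZagierPeriods.Cruxes.StokesGeneration.FibrewiseStokes

open MeasureTheory Set
open Literature.NumberTheory.Transcendental
open Literature.NumberTheory.Transcendental.KZ
open Literature.ModelTheory.ExponentialFields (IsSemialgebraic)
open Literature.Analysis.Calculus (jacobianMatrix jacCofactor piolaField)


/-- Fibre derivative of a component of a differentiable vector field along a coordinate line. [folklore] -/
theorem hasDerivAt_apply_update_of_hasFDerivAt {M : ℕ} {W : (Fin M → ℝ) → (Fin M → ℝ)}
    {L : (Fin M → ℝ) →L[ℝ] (Fin M → ℝ)} {z : Fin M → ℝ} (hW : HasFDerivAt W L z) (j k : Fin M) :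
    HasDerivAt (fun s : ℝ => W (Function.update z j s) k) (L (Pi.single j 1) k) (z j) := by
  have hγ : HasDerivAt (Function.update z j) (Pi.single j (1:ℝ)) (z j) := hasDerivAt_update z j (z j)
  have hcomp : HasDerivAt (fun s : ℝ => W (Function.update z j s)) (L (Pi.single j 1)) (z j) := by
    have hz : Function.update z j (z j) = z := Function.update_eq_self j z
    have hW' : HasFDerivAt W L (Function.update z j (z j)) := by rw [hz]; exact hW
    exact hW'.comp_hasDerivAt (z j) hγ
  exact (hasDerivAt_pi.mp hcomp) k

/-- **Rung 15 (lead c6): Kontsevich–Zagier's rule (2) for a general face-preserving `C²` self-map of the closed cube,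
in every dimension, inside the fibrewise-Stokes economy.** Let `U ⊇ [0,1]^N` be open, `h : U → ℝ` a `ℚ`-semialgebraic
`C¹` integrand and `Φ : U → ℝ^N` a `ℚ`-semialgebraic `C²` map sending the closed cube into itself and each closed face
`{x_j = c}` (`c ∈ {0,1}`) into itself (no injectivity required). Then the change-of-variables relator
`h − (h∘Φ)·det DΦ` is fibrewise-Stokes decomposable: `N + 1` elements on `[0,1]^{N+1}`, the components of the Piola
field `W = adj(DF)·(h e_t ∘ F)` of the suspension `F(x,t) = ((1−t)x + tΦ(x), t)`, each along its own coordinate; the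
fibre derivatives sum to `div W = 0` (the Jacobian determinant is a null Lagrangian: Jacobi's formula and Piola's
identity, `Literature.Analysis.Calculus.sum_fderiv_piolaField`), the `t`-faces give `(h∘Φ)det DΦ − h` and the `x_j`-faces
vanish. With rungs 12–14 (symmetries, triangular reparametrisations, subdivisions) this completes the absorption of rule (2)
on the cube for `C²` data: every move of the smooth cubical calculus is a theorem of S2's economy.
[cite: KontsevichZagier2001, §1.2 rule (2)] -/
theorem fibStokesDecomposable_sub_pullback {N : ℕ} (U : Set (Fin N → ℝ)) (hU : IsOpen U)
    (hCU : Set.pi Set.univ (fun _ : Fin N => Set.Icc (0:ℝ) 1) ⊆ U)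
    (Φ : (Fin N → ℝ) → (Fin N → ℝ)) (h : (Fin N → ℝ) → ℝ)
    (hΦsa : IsSemialgebraicMapOn ℚ U Φ) (hhsa : IsSemialgebraicFunOn ℚ U h)
    (hΦd : ContDiffOn ℝ 2 Φ U) (hhd : ContDiffOn ℝ 1 h U)
    (hΦC : Set.MapsTo Φ (Set.pi Set.univ (fun _ : Fin N => Set.Icc (0:ℝ) 1))
      (Set.pi Set.univ (fun _ : Fin N => Set.Icc (0:ℝ) 1)))
    (hface : ∀ x ∈ Set.pi Set.univ (fun _ : Fin N => Set.Icc (0:ℝ) 1), ∀ j : Fin N,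
      (x j = 0 → Φ x j = 0) ∧ (x j = 1 → Φ x j = 1)) :
    FibStokesDecomposable N (fun x => h x - h (Φ x) * (fderiv ℝ Φ x).det) := by
  classical
  set C : Set (Fin N → ℝ) := Set.pi Set.univ (fun _ : Fin N => Set.Icc (0:ℝ) 1) with hC
  set C' : Set (Fin (N + 1) → ℝ) := Set.pi Set.univ (fun _ : Fin (N + 1) => Set.Icc (0:ℝ) 1) with hC'
  have hC'sa : IsSemialgebraic ℚ C' := by rw [hC', ← cube_eq_pi]; exact isSemialgebraic_cube
  have hC'c : IsCompact C' := isCompact_univ_pi fun _ => isCompact_Icc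
  -- the suspension `F`, the field `G`, the open set `W'`
  obtain ⟨F, hF⟩ : ∃ F : (Fin (N + 1) → ℝ) → (Fin (N + 1) → ℝ), F = fun z =>
      Fin.snoc (fun k => (1 - z (Fin.last N)) * z (Fin.castSucc k) +
        z (Fin.last N) * Φ (fun l => z (Fin.castSucc l)) k) (z (Fin.last N)) := ⟨_, rfl⟩
  obtain ⟨G, hG⟩ : ∃ G : (Fin (N + 1) → ℝ) → (Fin (N + 1) → ℝ), G = fun y =>
      Pi.single (Fin.last N) (h (fun l => y (Fin.castSucc l))) := ⟨_, rfl⟩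
  set W' : Set (Fin (N + 1) → ℝ) := {z | (fun l => z (Fin.castSucc l)) ∈ U ∧
      (fun l => F z (Fin.castSucc l)) ∈ U} with hW'
  -- K4: regularity; K5: semialgebraicity
  obtain ⟨hW'o, hFd, hGd, hWc⟩ := stub_suspension_regularity U hU Φ h hΦd hhd F hF G hG
  have hWdiff : DifferentiableOn ℝ (piolaField F G) W' := hWc.differentiableOn_one
  obtain ⟨hW'sa, hWsa, hDsa⟩ := stub_suspension_semialgebraic U hU Φ h hΦsa hhsa
    (hΦd.differentiableOn (by norm_num)) hhd.differentiableOn_one F hF G hG hW'o hWdiff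
  -- K3: the Jacobian of the suspension and the face property
  obtain ⟨hJ, hfaceD⟩ := stub_jacobianMatrix_suspension Φ F hF
  -- readings of the cube
  have hproj : ∀ z ∈ C', (fun l => z (Fin.castSucc l)) ∈ C := fun z hz =>
    Set.mem_univ_pi.mpr fun l => (Set.mem_univ_pi.mp hz) (Fin.castSucc l)
  have hlast : ∀ z ∈ C', z (Fin.last N) ∈ Set.Icc (0:ℝ) 1 := fun z hz => (Set.mem_univ_pi.mp hz) (Fin.last N)
  have hFproj : ∀ z, (fun l => F z (Fin.castSucc l)) = fun l => (1 - z (Fin.last N)) * z (Fin.castSucc l) +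
      z (Fin.last N) * Φ (fun l => z (Fin.castSucc l)) l := by
    intro z; funext l; rw [hF]; simp only [Fin.snoc_castSucc]
  have hconv : ∀ z ∈ C', (fun l => F z (Fin.castSucc l)) ∈ C := by
    intro z hz
    rw [hFproj z]
    have hx := hproj z hz
    have hΦx := hΦC hx
    have ht := hlast z hz
    refine Set.mem_univ_pi.mpr fun l => ?_
    have h1 := (Set.mem_univ_pi.mp hx) l
    have h2 := (Set.mem_univ_pi.mp hΦx) l
    simp only [Set.mem_Icc] at h1 h2 ht ⊢
    constructor <;> nlinarith [h1.1, h1.2, h2.1, h2.2, ht.1, ht.2]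
  have hC'W' : C' ⊆ W' := fun z hz => ⟨hCU (hproj z hz), hCU (hconv z hz)⟩
  -- differentiability data at points of `W'`
  have hU₁o : IsOpen {z : Fin (N + 1) → ℝ | (fun l => z (Fin.castSucc l)) ∈ U} :=
    hU.preimage (continuous_pi fun l => continuous_apply (Fin.castSucc l))
  have hFat : ∀ z ∈ W', ContDiffAt ℝ 2 F z := fun z hz =>
    hFd.contDiffAt (hU₁o.mem_nhds hz.1)
  have hGat : ∀ z ∈ W', DifferentiableAt ℝ G (F z) := fun z hz => (hGd (F z) hz.2).1
  have hWat : ∀ z ∈ W', HasFDerivAt (piolaField F G) (fderiv ℝ (piolaField F G) z) z := fun z hz =>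
    ((hWdiff z hz).differentiableAt (hW'o.mem_nhds hz)).hasFDerivAt
  have hWcont : ContinuousOn (piolaField F G) W' := hWc.continuousOn
  have hDcont : ∀ j, ContinuousOn (fun z => fderiv ℝ (piolaField F G) z (Pi.single j 1) j) W' := by
    intro j
    have h1 : ContinuousOn (fun z => fderiv ℝ (piolaField F G) z) W' :=
      hWc.continuousOn_fderiv_of_isOpen hW'o le_rfl
    have h2 : ContinuousOn (fun z => fderiv ℝ (piolaField F G) z (Pi.single j 1)) W' :=
      h1.clm_apply continuousOn_const
    exact (continuous_apply j).comp_continuousOn h2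
  -- the divergence vanishes on `W'`
  have hdiv : ∀ z ∈ W', ∑ j, fderiv ℝ (piolaField F G) z (Pi.single j 1) j = 0 := by
    intro z hz
    rw [Literature.Analysis.Calculus.sum_fderiv_piolaField (hFat z hz) (hGat z hz), (hGd (F z) hz.2).2, zero_mul]
  -- the elements: `Gel j = W_j`, `Del j = ∂_j W_j`
  obtain ⟨Gel, hGel⟩ : ∃ Gel : Fin (N + 1) → (Fin (N + 1) → ℝ) → ℝ, Gel = fun j z => piolaField F G z j := ⟨_, rfl⟩
  obtain ⟨Del, hDel⟩ : ∃ Del : Fin (N + 1) → (Fin (N + 1) → ℝ) → ℝ,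
      Del = fun j z => fderiv ℝ (piolaField F G) z (Pi.single j 1) j := ⟨_, rfl⟩
  have hGelsa : ∀ j, IsSemialgebraicFunOn ℚ C' (Gel j) := fun j => by rw [hGel]; exact (hWsa j).mono hC'W' hC'sa
  have hDelsa : ∀ j, IsSemialgebraicFunOn ℚ C' (Del j) := fun j => by rw [hDel]; exact (hDsa j).mono hC'W' hC'sa
  have hGelc : ∀ j, ContinuousOn (Gel j) C' := fun j => by
    rw [hGel]; exact ((continuous_apply j).comp_continuousOn hWcont).mono hC'W'
  have hDelc : ∀ j, ContinuousOn (Del j) C' := fun j => by rw [hDel]; exact (hDcont j).mono hC'W'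
  -- face maps
  have hupd : ∀ z ∈ C', ∀ (i : Fin (N + 1)), ∀ s ∈ Set.Icc (0:ℝ) 1, Function.update z i s ∈ C' :=
    fun z hz i s hs => update_mem_cubePi hz i hs
  have hface_sa : ∀ {Fn : (Fin (N + 1) → ℝ) → ℝ}, IsSemialgebraicFunOn ℚ C' Fn → ∀ (i : Fin (N + 1)) (t : ℝ),
      IsAlgebraic ℚ t → t ∈ Set.Icc (0:ℝ) 1 → IsSemialgebraicFunOn ℚ C' (fun x => Fn (Function.update x i t)) :=
    fun hFn i t ht htI => IsSemialgebraicFunOn.comp_isSemialgebraicMapOn_holds hFn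
      (isSemialgebraicMapOn_update_const i ht) fun x hx => hupd x hx i t htI
  have hface_c : ∀ {Fn : (Fin (N + 1) → ℝ) → ℝ}, ContinuousOn Fn C' → ∀ (i : Fin (N + 1)) (t : ℝ),
      t ∈ Set.Icc (0:ℝ) 1 → ContinuousOn (fun x => Fn (Function.update x i t)) C' :=
    fun hFn i t htI => hFn.comp (continuous_id.update i continuous_const).continuousOn fun x hx => hupd x hx i t htI
  have h0I : (0:ℝ) ∈ Set.Icc (0:ℝ) 1 := ⟨le_rfl, zero_le_one⟩
  have h1I : (1:ℝ) ∈ Set.Icc (0:ℝ) 1 := ⟨zero_le_one, le_rfl⟩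
  -- integrands and their cube representations
  obtain ⟨I, hI⟩ : ∃ I : Fin (N + 1) → (Fin (N + 1) → ℝ) → ℝ,
      I = fun j z => Del j z - (Gel j (Function.update z j 1) - Gel j (Function.update z j 0)) := ⟨_, rfl⟩
  have hIsa : ∀ j, IsSemialgebraicFunOn ℚ C' (I j) := fun j => by
    rw [hI]
    exact (hDelsa j).fun_sub ((hface_sa (hGelsa j) j 1 isAlgebraic_one h1I).fun_sub
      (hface_sa (hGelsa j) j 0 isAlgebraic_zero h0I))
  have hIc : ∀ j, ContinuousOn (I j) C' := fun j => by
    rw [hI]; exact (hDelc j).sub ((hface_c (hGelc j) j 1 h1I).sub (hface_c (hGelc j) j 0 h0I))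
  have hq : ∀ j, ∃ q : IntegralRep (N + 1), q.domain = C' ∧ q.integrand = I j := fun j =>
    exists_cubeRep (N + 1) (I j) (hIsa j) (hIc j)
  choose q hqd hqi using hq
  have hbound : ∀ {Fn : (Fin (N + 1) → ℝ) → ℝ}, ContinuousOn Fn C' → ∃ B : ℝ, ∀ x ∈ C', |Fn x| ≤ B := fun hFn => by
    obtain ⟨B, hB⟩ := hC'c.exists_bound_of_continuousOn hFn
    exact ⟨B, fun x hx => by simpa [Real.norm_eq_abs] using hB x hx⟩
  have hcu : ∀ (x : Fin (N + 1) → ℝ) (i : Fin (N + 1)), Continuous fun s : ℝ => Function.update x i s :=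
    fun x i => continuous_const.update i continuous_id
  -- the sum of the elements is decomposable
  have hdec : FibStokesDecomposable (N + 1) (fun z => ∑ j, (q j).integrand z) := by
    refine fibStokesDecomposable_of_elements (M := N + 1) (J := N + 1) id Gel Del q (fun j => ?_)
      (fun j => ⟨hqd j, fun z _ => by rw [hqi j, hI]; rfl⟩)
    refine ⟨hGelsa j, hDelsa j, hbound (hGelc j), fun z hz => ?_, fun z hz _ => ?_⟩
    · exact (hGelc j).comp (hcu z j).continuousOn fun s hs => hupd z hz j s hs
    · show HasDerivAt (fun s : ℝ => Gel j (Function.update z (id j) s)) (Del j z) (z (id j))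
      rw [hGel, hDel]
      exact hasDerivAt_apply_update_of_hasFDerivAt (hWat z (hC'W' hz)) j j
  -- reading the elements: `Gel j w = adj(DF w)_{j,last} · h((F w) ∘ castSucc)`
  have hGel_eq : ∀ j w, Gel j w = (jacobianMatrix F w).adjugate j (Fin.last N) * h (fun l => F w (Fin.castSucc l)) := by
    intro j w
    rw [hGel]
    simp only [piolaField, hG]
    rw [Finset.sum_eq_single (Fin.last N) (fun i _ hi => by simp [hi]) (fun h' => (h' (Finset.mem_univ _)).elim)]
    rw [Literature.Analysis.Calculus.jacCofactor_eq_adjugate]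
    simp
  -- the last row of `DF` at points of `W'`
  have hΦdiff : ∀ w ∈ W', DifferentiableAt ℝ Φ (fun l => w (Fin.castSucc l)) := fun w hw =>
    (hΦd.differentiableOn (by norm_num)).differentiableAt (hU.mem_nhds hw.1)
  have hproj_upd_last : ∀ (z : Fin (N + 1) → ℝ) (c : ℝ),
      (fun l => Function.update z (Fin.last N) c (Fin.castSucc l)) = fun l => z (Fin.castSucc l) := by
    intro z c; funext l; rw [Function.update_of_ne (Fin.castSucc_lt_last l).ne]
  have hproj_upd_cs : ∀ (z : Fin (N + 1) → ℝ) (j : Fin N) (c : ℝ),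
      (fun l => Function.update z (Fin.castSucc j) c (Fin.castSucc l)) =
        Function.update (fun l => z (Fin.castSucc l)) j c := by
    intro z j c; funext l
    rcases eq_or_ne l j with rfl | hlj
    · simp
    · rw [Function.update_of_ne ((Fin.castSucc_injective N).ne hlj), Function.update_of_ne hlj]
  -- the `t`-faces
  have hface_last : ∀ z ∈ C', Gel (Fin.last N) (Function.update z (Fin.last N) 1) -
      Gel (Fin.last N) (Function.update z (Fin.last N) 0) =
      (fderiv ℝ Φ (fun l => z (Fin.castSucc l))).det * h (Φ (fun l => z (Fin.castSucc l))) -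
        h (fun l => z (Fin.castSucc l)) := by
    intro z hz
    have hw : ∀ c ∈ Set.Icc (0:ℝ) 1, Function.update z (Fin.last N) c ∈ W' := fun c hc =>
      hC'W' (hupd z hz _ c hc)
    have key : ∀ c ∈ Set.Icc (0:ℝ) 1, Gel (Fin.last N) (Function.update z (Fin.last N) c) =
        (Matrix.of fun k l => (1 - c) * (if k = l then 1 else 0) +
          c * jacobianMatrix Φ (fun l => z (Fin.castSucc l)) k l).det *
        h (fun l => (1 - c) * z (Fin.castSucc l) + c * Φ (fun l => z (Fin.castSucc l)) l) := by
      intro c hc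
      set w := Function.update z (Fin.last N) c with hwdef
      obtain ⟨-, hJcc, -, hJrow, hJone⟩ := hJ w (hΦdiff w (hw c hc))
      obtain ⟨hK1a, -, -⟩ := stub_adjugate_blockTriangular (jacobianMatrix F w) hJrow hJone
      rw [hGel_eq, hK1a, hFproj w]
      have hwl : w (Fin.last N) = c := by rw [hwdef]; exact Function.update_self _ _ _
      have hwc : (fun l => w (Fin.castSucc l)) = fun l => z (Fin.castSucc l) := by rw [hwdef]; exact hproj_upd_last z c
      have hwc' : ∀ l, w (Fin.castSucc l) = z (Fin.castSucc l) := fun l => congrFun hwc l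
      congr 1
      · congr 1
        ext k l
        simp only [Matrix.submatrix_apply, Matrix.of_apply, hJcc, hwl, hwc]
      · simp only [hwl, hwc']
    rw [key 1 h1I, key 0 h0I]
    have e1 : (Matrix.of fun k l => (1 - (1:ℝ)) * (if k = l then 1 else 0) +
        (1:ℝ) * jacobianMatrix Φ (fun l => z (Fin.castSucc l)) k l) = jacobianMatrix Φ (fun l => z (Fin.castSucc l)) := by
      ext k l; simp
    have e0 : (Matrix.of fun k l => (1 - (0:ℝ)) * (if k = l then 1 else 0) +
        (0:ℝ) * jacobianMatrix Φ (fun l => z (Fin.castSucc l)) k l) = (1 : Matrix (Fin N) (Fin N) ℝ) := by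
      ext k l; simp [Matrix.one_apply]
    rw [e1, e0, Matrix.det_one, one_mul, Literature.Analysis.Calculus.det_jacobianMatrix]
    simp
  -- the `x_j`-faces vanish
  have hface_cs : ∀ z ∈ C', ∀ (j : Fin N) (c : ℝ), (c = 0 ∨ c = 1) →
      Gel (Fin.castSucc j) (Function.update z (Fin.castSucc j) c) = 0 := by
    intro z hz j c hc
    have hcI : c ∈ Set.Icc (0:ℝ) 1 := by rcases hc with rfl | rfl <;> [exact h0I; exact h1I]
    set w := Function.update z (Fin.castSucc j) c with hwdef
    have hwC : w ∈ C' := hupd z hz _ c hcI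
    have hwW : w ∈ W' := hC'W' hwC
    obtain ⟨-, hJcc, hJcol, hJrow, hJone⟩ := hJ w (hΦdiff w hwW)
    obtain ⟨-, -, hK1c⟩ := stub_adjugate_blockTriangular (jacobianMatrix F w) hJrow hJone
    rw [hGel_eq, hK1c]
    set x' : Fin N → ℝ := fun l => w (Fin.castSucc l) with hx'
    have hx'C : x' ∈ C := hproj w hwC
    have hx'j : x' j = c := by
      show Function.update z (Fin.castSucc j) c (Fin.castSucc j) = c
      exact Function.update_self _ _ _
    have hx'j01 : x' j = 0 ∨ x' j = 1 := by rw [hx'j]; exact hc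
    have hΦj : Φ x' j = c := by
      rcases hc with rfl | rfl
      · exact (hface x' hx'C j).1 hx'j
      · exact (hface x' hx'C j).2 hx'j
    have hzero : ∑ l : Fin N, ((jacobianMatrix F w).submatrix Fin.castSucc Fin.castSucc).adjugate j l *
        jacobianMatrix F w (Fin.castSucc l) (Fin.last N) = 0 := by
      simp only [hJcol]
      refine stub_adjugate_mulVec_face _ j (fun k hk => ?_) (fun l => Φ x' l - w (Fin.castSucc l)) ?_
      · simp only [Matrix.submatrix_apply, hJcc]
        have hne : ¬ (j = k) := fun h' => hk h'.symm
        rw [if_neg hne, mul_zero, zero_add]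
        rw [hfaceD U hU hCU (hΦd.differentiableOn (by norm_num)) hface x' hx'C j hx'j01 k hk, mul_zero]
      · show Φ x' j - w (Fin.castSucc j) = 0
        rw [hΦj]; show c - x' j = 0; rw [hx'j, sub_self]
    rw [hzero, neg_zero, zero_mul]
  -- un-pad; it remains to identify the sum on the cube
  have hle : N ≤ N + 1 := N.le_succ
  refine fibStokesDecomposable_unpad hle _ (fibStokesDecomposable_congr_off_null (N + 1) _ _ ∅
    Literature.ModelTheory.ExponentialFields.isSemialgebraic_empty measure_empty (fun z hz _ => ?_) hdec)
  have hcast : (fun l => z (Fin.castLE hle l)) = fun l => z (Fin.castSucc l) := rfl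
  simp only [hqi, hI, hcast]
  rw [Finset.sum_sub_distrib]
  have hsumD : ∑ j, Del j z = 0 := by rw [hDel]; exact hdiv z (hC'W' hz)
  rw [hsumD, zero_sub, Fin.sum_univ_castSucc, hface_last z hz]
  have hcs0 : ∑ j : Fin N, (Gel (Fin.castSucc j) (Function.update z (Fin.castSucc j) 1) -
      Gel (Fin.castSucc j) (Function.update z (Fin.castSucc j) 0)) = 0 :=
    Finset.sum_eq_zero fun j _ => by
      rw [hface_cs z hz j 1 (Or.inr rfl), hface_cs z hz j 0 (Or.inl rfl), sub_self]
  rw [hcs0, zero_add]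
  ring


end Summit.KontsevichZagierPeriods.KontsevichZagierPeriods.Cruxes.StokesGeneration.FibrewiseStokes

end
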